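import Summits.HubbardSuperconductivity.HubbardSuperconductivity.Theorems.DeformationLadderLadderThesisThermalLift

/-!
# Crux-ideate round 2, ideator 5 — `LowEnergyRigidity` (stmt-HubbardSuperconductivity-1892)

Sketch file of planner-cruxidea-stmt-HubbardSuperconductivity-1892-5-0 (2026-08-16).
No idea card is filed this round (see `Negative-notes/ideator5-r2.md`); this file kernel-checks the
one BY-PRODUCT that lives over tree vocabulary:

§A **The cold door (concavity jamb of the thermal door).** For Hermitian `A, W` and `β > 0`,
`E₀(A + W) − E₀(A) ≥ Re⟨W⟩_{β, A + W} − (log D)/β` — the mirror of the tree's thermal FLOOR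
(`groundEnergy_sub_le_thermalFloor`, Peierls–Bogoliubov at `A`) and a Golden–Thompson-free twin of
the thermal LIFT (`thermalLift_groundEnergy_sub_ge`): the perturbation is evaluated in the PERTURBED
Gibbs state, where concavity of `s ↦ F_β(A + sW)` makes `⟨W⟩_{β,A+sW}` antitone, so one thermal
one-point function at the END of the penalty interval bounds the whole penalty gap. Composed with
the landed normal form `lowEnergyRigidity_of_penaltyGap` it gives the crux from ONE cold thermal
expectation of the penalised, sector-compressed Hubbard torus (`lowEnergyRigidity_of_coldPenalisedOrder`).
This is an exact normal form of the crux (the converse holds up to constants, on paper), recorded as a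
tool; it is NOT an idea card (the residual is the crux itself in thermal dress — costume by the r1/r2
triage standard).
-/

noncomputable section

set_option linter.dupNamespace false

namespace Summit.HubbardSuperconductivity.HubbardSuperconductivity.Cruxes.LowEnergyRigidity.Ideator5

open Matrix Literature.MathematicalPhysics.QuantumLattice Literature.Probability.LatticeModels
open Summit.HubbardSuperconductivity.HubbardSuperconductivity.Theses.DeformationLadder
open Summit.HubbardSuperconductivity.HubbardSuperconductivity.Theorems.DeformationLadder
open scoped ComplexOrder

/-! ### §A  The cold door for finite Hermitian matrices -/

section ColdDoor

variable {m : Type*} [Fintype m] [DecidableEq m]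

/-- **Cold door.** For Hermitian `A, W` on a nonempty index type and `β > 0`:
`Re⟨W⟩_{β, A+W} − (log D)/β ≤ E₀(A + W) − E₀(A)`, `D = card m`.
Proof: Peierls–Bogoliubov at the PERTURBED matrix, `Z_β(A) = Z_β((A+W) + (−W)) ≥ Z_β(A+W) e^{+β⟨W⟩_{β,A+W}}`,
with `Z_β(A+W) ≥ e^{−βE₀(A+W)}` and `Z_β(A) ≤ D e^{−βE₀(A)}`. Bratteli–Robinson II §5.3.1 (Peierls–Bogoliubov);
the tree's `Matrix.peierls_bogoliubov`, `exp_neg_mul_groundEnergy_le_partitionFn`, `partitionFn_le_card_mul_exp`. -/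
theorem groundEnergy_sub_ge_coldDoor [Nonempty m] {A W : Matrix m m ℂ} (hA : A.IsHermitian)
    (hW : W.IsHermitian) {β : ℝ} (hβ : 0 < β) :
    (gibbsState β (A + W) W).re - Real.log (Fintype.card m) / β ≤
      (A + W).groundEnergy - A.groundEnergy := by
  have hAW : (A + W).IsHermitian := hA.add hW
  have hnW : (-W).IsHermitian := hW.neg
  -- Peierls–Bogoliubov at `H := A + W` with perturbation `-W`
  have hPB := Matrix.peierls_bogoliubov hAW hnW β
  have hsum : A + W + -W = A := by abel
  rw [hsum, map_neg, Complex.neg_re] at hPB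
  -- `hPB : (Z(A+W)).re * exp(-(β * -g)) ≤ (Z A).re`, `g := Re⟨W⟩_{β,A+W}`
  set g : ℝ := (gibbsState β (A + W) W).re with hg
  have hZAW := exp_neg_mul_groundEnergy_le_partitionFn hAW β
  have hZA := partitionFn_le_card_mul_exp hA hβ.le
  have hD : (0 : ℝ) < Fintype.card m := by exact_mod_cast Fintype.card_pos
  have hexp : Real.exp (-(β * (A + W).groundEnergy)) * Real.exp (β * g) ≤
      Fintype.card m * Real.exp (-(β * A.groundEnergy)) := by
    have h1 : Real.exp (-(β * (A + W).groundEnergy)) * Real.exp (β * g) ≤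
        (partitionFn β (A + W)).re * Real.exp (β * g) :=
      mul_le_mul_of_nonneg_right hZAW (Real.exp_pos _).le
    have h2 : (partitionFn β (A + W)).re * Real.exp (β * g) ≤ (partitionFn β A).re := by
      have e : -(β * -g) = β * g := by ring
      rw [e] at hPB
      exact hPB
    exact h1.trans (h2.trans hZA)
  rw [← Real.exp_add] at hexp
  -- take logarithms
  have hlog := Real.log_le_log (Real.exp_pos _) hexp
  rw [Real.log_exp, Real.log_mul hD.ne' (Real.exp_pos _).ne', Real.log_exp] at hlog
  -- `-(β E₀(A+W)) + β g ≤ log D + -(β E₀(A))`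
  have hkey : β * (g - Real.log (Fintype.card m) / β) ≤
      β * ((A + W).groundEnergy - A.groundEnergy) := by
    have e : β * (g - Real.log (Fintype.card m) / β) = β * g - Real.log (Fintype.card m) := by
      field_simp
    rw [e]
    linarith
  exact le_of_mul_le_mul_left hkey hβ

end ColdDoor

/-! ### §A'  Composition: one cold thermal expectation of the penalised torus ⇒ the crux -/

section Corner

set_option synthInstance.maxSize 512

/-- **`LowEnergyRigidity` through the cold door.** Suppose that for some `U > 0`, `δ ∈ (0,1/2)`,
`s > 0`, `c > 0`, inverse temperatures `β_L > 0` and all large even `L`, with `H_L = hubbardTorus 2 L 1 U`,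
`P_L = (s/L⁴)·Δ_dᴴΔ_d` and `p` the occupation sets of the `(N_L/2, N_L/2)` sector:
(i) (cold) `log dim(Fock) / β_L ≤ c s / 2` — e.g. `β_L = 4 L² log 2/(c s)`, since `dim Fock = 2^{2L²}`; and
(ii) (thermal order of the penalised model) `c·s ≤ Re ⟨P_L|_p⟩` in the Gibbs state of `(H_L + P_L)|_p`
at `β_L` — i.e. d-wave LRO DENSITY `≥ c` of the cold Gibbs state of the PENALISED sector-compressed torus.
Then `LowEnergyRigidity`: the cold door gives the sector penalty gap `≥ c s − c s/2 = (c/2)·s`, block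
ground energies are sector energies (`stub_blockGroundEnergy`), and `lowEnergyRigidity_of_penaltyGap`
concludes. -/
theorem lowEnergyRigidity_of_coldPenalisedOrder
    (h : ∃ U : ℝ, 0 < U ∧ ∃ δ ∈ Set.Ioo (0:ℝ) (1 / 2), ∃ s : ℝ, 0 < s ∧ ∃ c : ℝ, 0 < c ∧
      ∃ β : ℕ → ℝ, ∃ L₀ : ℕ, ∀ (L : ℕ) [NeZero L], L₀ ≤ L → Even L →
        0 < β L ∧
        Real.log (Fintype.card (Finset (Orb (FermionTorus 2 L)))) / β L ≤ c * s / 2 ∧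
        c * s ≤ (gibbsState (β L)
            ((hubbardTorus 2 L 1 U + ((s / (L : ℝ) ^ 4 : ℝ) : ℂ) •
                ((pairField dWaveFormFactor L)ᴴ * pairField dWaveFormFactor L)).toBlock
              (fun σ => (upPart σ).card = ⌊(1 - δ) * (L : ℝ) ^ 2 / 2⌋₊ ∧
                (downPart σ).card = ⌊(1 - δ) * (L : ℝ) ^ 2 / 2⌋₊)
              (fun σ => (upPart σ).card = ⌊(1 - δ) * (L : ℝ) ^ 2 / 2⌋₊ ∧
                (downPart σ).card = ⌊(1 - δ) * (L : ℝ) ^ 2 / 2⌋₊))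
            ((((s / (L : ℝ) ^ 4 : ℝ) : ℂ) •
                ((pairField dWaveFormFactor L)ᴴ * pairField dWaveFormFactor L)).toBlock
              (fun σ => (upPart σ).card = ⌊(1 - δ) * (L : ℝ) ^ 2 / 2⌋₊ ∧
                (downPart σ).card = ⌊(1 - δ) * (L : ℝ) ^ 2 / 2⌋₊)
              (fun σ => (upPart σ).card = ⌊(1 - δ) * (L : ℝ) ^ 2 / 2⌋₊ ∧
                (downPart σ).card = ⌊(1 - δ) * (L : ℝ) ^ 2 / 2⌋₊))).re) :
    LowEnergyRigidity := by
  obtain ⟨U, hU, δ, hδ, s, hs, c, hc, β, L₀, hyp⟩ := h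
  apply lowEnergyRigidity_of_penaltyGap
  refine ⟨U, hU, δ, hδ, s, hs, c / 2, by positivity, L₀, fun L _ hL hE => ?_⟩
  obtain ⟨hβ, hcold, hord⟩ := hyp L hL hE
  -- names
  set n : ℕ := ⌊(1 - δ) * (L : ℝ) ^ 2 / 2⌋₊ with hn
  set p : Finset (Orb (FermionTorus 2 L)) → Prop :=
    fun σ => (upPart σ).card = n ∧ (downPart σ).card = n with hp
  set H := hubbardTorus 2 L 1 U with hH
  set P := ((s / (L : ℝ) ^ 4 : ℝ) : ℂ) •
    ((pairField dWaveFormFactor L)ᴴ * pairField dWaveFormFactor L) with hP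
  -- `n ≤ L²`
  have hnL : n ≤ L ^ 2 := by
    have h1 : ((1 - δ) * (L : ℝ) ^ 2 / 2) ≤ (L : ℝ) ^ 2 := by
      have hδ0 := hδ.1
      have : 0 ≤ (L : ℝ) ^ 2 := by positivity
      nlinarith
    have h2 : (n : ℝ) ≤ (L : ℝ) ^ 2 :=
      (Nat.floor_le (by nlinarith [hδ.1, hδ.2, sq_nonneg (L : ℝ)])).trans h1
    exact_mod_cast h2
  -- hermiticity / positivity
  have hHh : H.IsHermitian := by
    have h := isHermitian_hubbardTorusWith L 1 U 0
    rwa [hubbardTorusWith_zero] at h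
  have hPpsd : P.PosSemidef :=
    (pairField_conjTranspose_mul_self_posSemidef dWaveFormFactor L).smul (by positivity)
  have hPh : P.IsHermitian := hPpsd.isHermitian
  have hHP : (H + P).IsHermitian := hHh.add hPh
  -- the block index type is nonempty
  have hcard : Fintype.card (FermionTorus 2 L) = L ^ 2 :=
    Summit.HubbardSuperconductivity.NoGo.card_fermionTorus_two L
  obtain ⟨α, -, hα⟩ := Finset.exists_subset_card_eq (s := (Finset.univ : Finset (FermionTorus 2 L)))
    (n := n) (by rw [Finset.card_univ, hcard]; exact hnL)
  haveI : Nonempty {σ : Finset (Orb (FermionTorus 2 L)) // p σ} :=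
    ⟨⟨pairSet α α, by rw [upPart_pairSet, hα], by rw [downPart_pairSet, hα]⟩⟩
  -- blocks
  have hHb : (H.toBlock p p).IsHermitian := hHh.submatrix _
  have hPb : (P.toBlock p p).IsHermitian := hPh.submatrix _
  have hadd : (H + P).toBlock p p = H.toBlock p p + P.toBlock p p := rfl
  have e1 : (H.toBlock p p).groundEnergy = H.minEnergyOn (szSector (2 * n) 0) :=
    Summit.HubbardSuperconductivity.HubbardSuperconductivity.Theorems.CwThesis.stub_blockGroundEnergy L H hHh hnL
  have e2 : ((H + P).toBlock p p).groundEnergy = (H + P).minEnergyOn (szSector (2 * n) 0) :=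
    Summit.HubbardSuperconductivity.HubbardSuperconductivity.Theorems.CwThesis.stub_blockGroundEnergy L (H + P) hHP hnL
  -- the cold door on the blocks
  have key := groundEnergy_sub_ge_coldDoor hHb hPb hβ
  rw [← hadd] at key
  rw [e1, e2] at key
  -- entropy of the block ≤ entropy of the whole Fock space
  have hsub : (Fintype.card {σ : Finset (Orb (FermionTorus 2 L)) // p σ} : ℝ) ≤
      Fintype.card (Finset (Orb (FermionTorus 2 L))) := by
    exact_mod_cast Fintype.card_subtype_le p
  have hDpos : (0 : ℝ) < Fintype.card {σ : Finset (Orb (FermionTorus 2 L)) // p σ} := by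
    exact_mod_cast Fintype.card_pos
  have hlogle : Real.log (Fintype.card {σ : Finset (Orb (FermionTorus 2 L)) // p σ}) / β L ≤
      Real.log (Fintype.card (Finset (Orb (FermionTorus 2 L)))) / β L :=
    div_le_div_of_nonneg_right (Real.log_le_log hDpos hsub) hβ.le
  have hord' : c * s ≤ (gibbsState (β L) ((H + P).toBlock p p) (P.toBlock p p)).re := hord
  have : c / 2 * s = c * s - c * s / 2 := by ring
  rw [this]
  linarith

end Corner

end Summit.HubbardSuperconductivity.HubbardSuperconductivity.Cruxes.LowEnergyRigidity.Ideator5
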